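import Mathlib
import HarnessLib
import Summits.HubbardSuperconductivity.HubbardSuperconductivity.Theorems.KLProgrammeKLRegimeTwoLegResummedChain
import Literature.MathematicalPhysics.QuantumLattice.HubbardResummedCovarianceDetBound

/-!
# K3 ENGINE (stmt-HubbardSuperconductivity-20236), two-leg lane, (ρ2)(ii)′: the K-resummed representation of the scale-`n` self-energy
# WITHOUT the denominator hypothesis — `1 + Ψ·K/(βL²)` never vanishes for a real frame (`one_add_uvSymbolCT_mul_ne_zero`)

Cell gate-hubbard-kl, seat hubbard-kl-k3c5-p1 g7.  `…TwoLegResummedChain` (p516198) states the identity under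
`∀ ks, 1 + uvSymbolCT … ks · K(p_k⃗)/(βL²) ≠ 0`; by `HubbardResummedCovarianceDetBound.one_add_uvSymbolCT_mul_ne_zero` (p518807) this holds for
every `0 < β` (the denominator is `(−iν + e_K + wK)/(−iν + e_K)`, `ν ≠ 0`).  The versions below carry only `0 < β` and the unit partition
function:

* `klSelfEnergy_eq_chain_add_resummed'`, `klSelfEnergy_eq_frame_add_resummed_of_sq_add_sq_le'`.
-/

noncomputable section

namespace Summit.HubbardSuperconductivity.HubbardSuperconductivity.Theorems.KLRegimeSplit

set_option linter.dupNamespace false -- summit = problem name (single-conjunct summit), D-0017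

open Literature.MathematicalPhysics.QuantumLattice Literature.Probability.LatticeModels GrassmannAlgebra
open Summit.HubbardSuperconductivity.HubbardSuperconductivity.Theorems.KLProgrammeLegKernels

variable {L M : ℕ} [NeZero L]

/-- **The K-resummed representation, denominator hypothesis discharged**: for `0 < β` and unit partition function,
`Σ_n(k,σ) = K(p_k⃗) − βL²·κ²Ψ̃ + (1 − κΨ̃)²·selfEnergy (effAction (normalCovariance Ψ̃) V_U) (k,σ)`. -/
theorem klSelfEnergy_eq_chain_add_resummed' {β : ℝ} (hβ : 0 < β) (U μ : ℝ) (K : TrigPolyC4v) (e₀ : ℝ) (n : ℕ)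
    (hZ : IsUnit (hubbardEffPartitionFnCT L M β U μ 0 K (klScale e₀ n))) (k : FreqMomentum L M) (σ : Fin 2) :
    klSelfEnergy L M β U μ K e₀ n k σ =
      (K.eval (latticeMomentum L k.2) : ℂ) -
        ((β * (L : ℝ) ^ 2 : ℝ) : ℂ) * ((K.eval (latticeMomentum L k.2) / (β * (L : ℝ) ^ 2) : ℝ) : ℂ) ^ 2 *
          (uvSymbolCT L M β μ K (klScale e₀ n) (k, σ) /
            (1 + uvSymbolCT L M β μ K (klScale e₀ n) (k, σ) * ((K.eval (latticeMomentum L k.2) / (β * (L : ℝ) ^ 2) : ℝ) : ℂ))) +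
        (1 - ((K.eval (latticeMomentum L k.2) / (β * (L : ℝ) ^ 2) : ℝ) : ℂ) *
            (uvSymbolCT L M β μ K (klScale e₀ n) (k, σ) /
              (1 + uvSymbolCT L M β μ K (klScale e₀ n) (k, σ) * ((K.eval (latticeMomentum L k.2) / (β * (L : ℝ) ^ 2) : ℝ) : ℂ)))) ^ 2 *
          selfEnergy L M β (effAction ℂ (normalCovariance L M fun ks =>
            uvSymbolCT L M β μ K (klScale e₀ n) ks /
              (1 + uvSymbolCT L M β μ K (klScale e₀ n) ks * ((K.eval (latticeMomentum L ks.1.2) / (β * (L : ℝ) ^ 2) : ℝ) : ℂ)))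
            (hubbardInteraction L M β U)) k σ :=
  klSelfEnergy_eq_chain_add_resummed hβ.ne' U μ K e₀ n (fun ks => one_add_uvSymbolCT_mul_ne_zero hβ μ K (klScale e₀ n) ks) hZ k σ

/-- **On the geometric tube the chain is absent, denominator hypothesis discharged**: for `0 < β`, `0 < e₀`, unit partition function and
`ω² + e_K(k)² ≤ Λ_n²/4`: `Σ_n(k,σ) = K(p_k⃗) + selfEnergy (effAction (normalCovariance Ψ̃) V_U) (k,σ)`. -/
theorem klSelfEnergy_eq_frame_add_resummed_of_sq_add_sq_le' {β : ℝ} (hβ : 0 < β) (U μ : ℝ) (K : TrigPolyC4v) {e₀ : ℝ} (he₀ : 0 < e₀)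
    (n : ℕ) (hZ : IsUnit (hubbardEffPartitionFnCT L M β U μ 0 K (klScale e₀ n))) (k : FreqMomentum L M) (σ : Fin 2)
    (hk : matsubaraFreq β M k.1 ^ 2 + nambuXiCT L μ K k.2 ^ 2 ≤ klScale e₀ n ^ 2 / 4) :
    klSelfEnergy L M β U μ K e₀ n k σ =
      (K.eval (latticeMomentum L k.2) : ℂ) +
        selfEnergy L M β (effAction ℂ (normalCovariance L M fun ks =>
          uvSymbolCT L M β μ K (klScale e₀ n) ks /
            (1 + uvSymbolCT L M β μ K (klScale e₀ n) ks * ((K.eval (latticeMomentum L ks.1.2) / (β * (L : ℝ) ^ 2) : ℝ) : ℂ)))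
          (hubbardInteraction L M β U)) k σ :=
  klSelfEnergy_eq_frame_add_resummed_of_sq_add_sq_le hβ.ne' U μ K he₀ n
    (fun ks => one_add_uvSymbolCT_mul_ne_zero hβ μ K (klScale e₀ n) ks) hZ k σ hk

end Summit.HubbardSuperconductivity.HubbardSuperconductivity.Theorems.KLRegimeSplit

end
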